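import Literature.Topology.PlanarFoliations.StarHorizFamily
import Literature.Topology.PlanarFoliations.PathChartSign
import HarnessLib

/-!
# The hyperbolic arc through the axis of a prong star: adjacent prongs have opposite chart types

Topic: Topology / PlanarFoliations, sequel to `StarHorizFamily.lean` (near a prong point the
horizontals are read in one flow box with one monotonicity type in the sector parameter `β`) and
`PathChartSign.lean` (the chart sign of an injective leafwise path is constant). At a height
`h ≠ 0` the horizontal of the sector `j` and the horizontal of the neighbour `nb j h` form **one
injective leafwise arc through the axis point** (`hypArc`: `β` decreasing to `0` in `S j`, then
increasing from `0` in `S (nb j h)`; `continuous_toLeafSpace_hypArc`, `injOn_hypArc`). Its chart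
sign is constant, while `β` runs in opposite directions on the two halves; hence **the chart
types in `β` of the horizontals of the two sectors are opposite**
(`not_strictMonoOn_nb_of_strictMonoOn`, `not_strictAntiOn_nb_of_strictAntiOn`). With
`ProngDirection.lean`: adjacent prongs are one *in* and one *out*.

All statements are [folklore].
-/

noncomputable section

open Set Filter Function
open _root_.Topology
open Literature.Topology.FourManifolds Literature.Topology.FourManifolds.Foliation

namespace Literature.Topology.PlanarFoliations

namespace ProngStar

variable {X : Type*} [TopologicalSpace X] [Nonempty X] {F : Foliation ℝ X} {ι : X → ℂ} {v : ℂ} {n : ℕ}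
  (P : ProngStar F ι v n) (hι : IsOpenEmbedding ι)

/-- The clamped sector parameter on the left half (`β = -u`, clamped to `[0, ρ]`). [folklore] -/
def βL (u : ℝ) : ℝ := min P.ρ (max 0 (-u))

/-- The clamped sector parameter on the right half (`β = u`, clamped to `[0, ρ]`). [folklore] -/
def βR (u : ℝ) : ℝ := min P.ρ (max 0 u)

/-- **The hyperbolic arc at the height `h`**: the horizontal of `S j` traversed towards the axis
(`u ≤ 0`, `β = -u`), then the horizontal of the neighbour `S (nb j h)` away from the axis (`u ≥ 0`,
`β = u`). [folklore] -/
def hypArc (j : ZMod n) (h : ℝ) (u : ℝ) : X :=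
  if u ≤ 0 then P.horiz hι j h (P.βL u) else P.horiz hι (P.nb j h) h (P.βR u)

variable {P hι}

omit [Nonempty X] in
/-- The clamped parameters are in `[0, ρ]`. [folklore] -/
theorem βL_mem (u : ℝ) : P.βL u ∈ Icc 0 P.ρ := ⟨le_min P.ρ_pos.le (le_max_left _ _), min_le_left _ _⟩

omit [Nonempty X] in
/-- The clamped parameters are in `[0, ρ]`. [folklore] -/
theorem βR_mem (u : ℝ) : P.βR u ∈ Icc 0 P.ρ := ⟨le_min P.ρ_pos.le (le_max_left _ _), min_le_left _ _⟩

omit [Nonempty X] in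
/-- On `[-ρ, 0]` the left parameter is `-u`. [folklore] -/
theorem βL_eq {u : ℝ} (hu : u ∈ Icc (-P.ρ) 0) : P.βL u = -u := by
  rw [βL, max_eq_right (by linarith [hu.2]), min_eq_right (by linarith [hu.1])]

omit [Nonempty X] in
/-- On `[0, ρ]` the right parameter is `u`. [folklore] -/
theorem βR_eq {u : ℝ} (hu : u ∈ Icc 0 P.ρ) : P.βR u = u := by
  rw [βR, max_eq_right hu.1, min_eq_right hu.2]

omit [Nonempty X] in
/-- The clamped parameters are continuous. [folklore] -/
theorem continuous_βL : Continuous P.βL := continuous_const.min (continuous_const.max continuous_neg)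

omit [Nonempty X] in
/-- The clamped parameters are continuous. [folklore] -/
theorem continuous_βR : Continuous P.βR := continuous_const.min (continuous_const.max continuous_id)

/-- Values on the left half. [folklore] -/
theorem hypArc_of_nonpos {j : ZMod n} {h u : ℝ} (hu : u ∈ Icc (-P.ρ) 0) : P.hypArc hι j h u = P.horiz hι j h (-u) := by
  rw [hypArc, if_pos hu.2, βL_eq hu]

/-- Values on the right half. [folklore] -/
theorem hypArc_of_nonneg {j : ZMod n} {h u : ℝ} (hh : h ∈ Icc (-P.ρ) P.ρ) (hu : u ∈ Icc 0 P.ρ) :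
    P.hypArc hι j h u = P.horiz hι (P.nb j h) h u := by
  rcases eq_or_lt_of_le hu.1 with h0 | hpos
  · rw [← h0, hypArc, if_pos le_rfl, show P.βL 0 = 0 by rw [βL_eq ⟨by linarith [P.ρ_pos], le_rfl⟩, neg_zero], P.horiz_nb_zero hι hh]
  · rw [hypArc, if_neg (not_le.2 hpos), βR_eq hu]

/-- **The hyperbolic arc is continuous in the leaf topology** (`h ≠ 0`). [folklore] -/
theorem continuous_toLeafSpace_hypArc {j : ZMod n} {h : ℝ} (hh : h ∈ Icc (-P.ρ) P.ρ) (hh0 : h ≠ 0) :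
    Continuous (toLeafSpace ∘ P.hypArc hι j h : ℝ → F.LeafSpace) := by
  have hT : ∀ β ∈ Icc 0 P.ρ, ((β, h) : ℝ × ℝ) ∈ P.rect ∧ ((β, h) : ℝ × ℝ) ≠ 0 := fun β hβ ↦
    ⟨(P.mem_rect_iff).2 ⟨hβ, hh⟩, fun h0 ↦ hh0 (congrArg Prod.snd h0)⟩
  have hL : Continuous (toLeafSpace ∘ fun u ↦ P.horiz hι j h (P.βL u) : ℝ → F.LeafSpace) :=
    (P.continuousOn_toLeafSpace_horiz hι (j := j) hT).comp_continuous continuous_βL βL_mem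
  have hR : Continuous (toLeafSpace ∘ fun u ↦ P.horiz hι (P.nb j h) h (P.βR u) : ℝ → F.LeafSpace) :=
    (P.continuousOn_toLeafSpace_horiz hι (j := P.nb j h) hT).comp_continuous continuous_βR βR_mem
  have heq : (toLeafSpace ∘ P.hypArc hι j h : ℝ → F.LeafSpace) =
      fun u ↦ if u ≤ 0 then (toLeafSpace ∘ fun u ↦ P.horiz hι j h (P.βL u)) u else (toLeafSpace ∘ fun u ↦ P.horiz hι (P.nb j h) h (P.βR u)) u := by
    funext u; simp only [comp_apply, hypArc]; split_ifs <;> rfl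
  rw [heq]
  refine Continuous.if_le hL hR continuous_id continuous_const fun u hu ↦ ?_
  simp only [comp_apply, hu, show P.βL 0 = 0 by rw [βL_eq ⟨by linarith [P.ρ_pos], le_rfl⟩, neg_zero],
    show P.βR 0 = 0 by rw [βR_eq ⟨le_rfl, P.ρ_pos.le⟩], P.horiz_nb_zero hι hh]

omit [Nonempty X] in
/-- A point of the sector with positive sector coordinate is not in the neighbouring sector.
[folklore] -/
theorem not_mem_nb_of_b_pos {j : ZMod n} {z : ℂ} (hz : z ∈ P.S j) (hb : 0 < P.b j z) (h : ℝ) : z ∉ P.S (P.nb j h) := by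
  intro hz'
  rcases P.nb_eq_or j h with hnb | hnb
  · rw [hnb] at hz'
    have hmem : z ∈ P.S (j - 1) ∩ P.S (j - 1 + 1) := by rw [sub_add_cancel]; exact ⟨hz', hz⟩
    rw [P.inter_succ'] at hmem
    rw [sub_add_cancel] at hmem
    linarith [hmem.2.1]
  · rw [hnb] at hz'
    have hmem : z ∈ P.S j ∩ P.S (j + 1) := ⟨hz, hz'⟩
    rw [P.inter_succ] at hmem
    linarith [hmem.2.1]

/-- **The hyperbolic arc is injective** on `(-ρ, ρ)` (`h ≠ 0`). [folklore] -/
theorem injOn_hypArc {j : ZMod n} {h : ℝ} (hh : h ∈ Icc (-P.ρ) P.ρ) (hh0 : h ≠ 0) : InjOn (P.hypArc hι j h) (Ioo (-P.ρ) P.ρ) := by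
  have hr : ∀ β ∈ Icc 0 P.ρ, ((β, h) : ℝ × ℝ) ∈ P.rect ∧ ((β, h) : ℝ × ℝ) ≠ 0 := fun β hβ ↦
    ⟨(P.mem_rect_iff).2 ⟨hβ, hh⟩, fun h0 ↦ hh0 (congrArg Prod.snd h0)⟩
  -- the images
  have himL : ∀ {u}, u ∈ Icc (-P.ρ) 0 → ι (P.hypArc hι j h u) = P.pt j (-u, h) := fun {u} hu ↦ by
    rw [hypArc_of_nonpos hu]; exact P.ι_horiz hι (hr (-u) ⟨by linarith [hu.2], by linarith [hu.1]⟩).1 (hr (-u) ⟨by linarith [hu.2], by linarith [hu.1]⟩).2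
  have himR : ∀ {u}, u ∈ Icc 0 P.ρ → ι (P.hypArc hι j h u) = P.pt (P.nb j h) (u, h) := fun {u} hu ↦ by
    rw [hypArc_of_nonneg hh hu]; exact P.ι_horiz hι (hr u hu).1 (hr u hu).2
  -- chart injectivity within a sector
  have hinj : ∀ (k : ZMod n) {β β' : ℝ}, β ∈ Icc 0 P.ρ → β' ∈ Icc 0 P.ρ → P.pt k (β, h) = P.pt k (β', h) → β = β' := by
    intro k β β' hβ hβ' heq
    have := congrArg (P.chart k) heq
    rw [P.chart_pt (hr β hβ).1, P.chart_pt (hr β' hβ').1] at this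
    exact congrArg Prod.fst this
  intro u hu u' hu' huu'
  have hι' := congrArg ι huu'
  rcases le_or_gt u 0 with hul | hur <;> rcases le_or_gt u' 0 with hul' | hur'
  · rw [himL ⟨hu.1.le, hul⟩, himL ⟨hu'.1.le, hul'⟩] at hι'
    linarith [hinj j ⟨by linarith, by linarith [hu.1]⟩ ⟨by linarith, by linarith [hu'.1]⟩ hι']
  · -- left point with `β = -u`, right point with `β = u' > 0`: different sectors
    exfalso
    rw [himL ⟨hu.1.le, hul⟩, himR ⟨hur'.le, hu'.2.le⟩] at hι'
    have hz : P.pt (P.nb j h) (u', h) ∈ P.S (P.nb j h) := P.pt_mem (hr u' ⟨hur'.le, hu'.2.le⟩).1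
    rw [← hι'] at hz
    rcases eq_or_lt_of_le (neg_nonneg.2 hul) with hu0 | hupos
    · -- `u = 0`: the axis point has `b (nb) = 0`, but the right point has `b = u' > 0`
      have hb : P.b (P.nb j h) (P.pt (P.nb j h) (u', h)) = u' := P.b_pt (hr u' ⟨hur'.le, hu'.2.le⟩).1
      rw [← hι', ← hu0] at hb
      have := (P.pt_axis_mem_nb (j := j) hh).2
      linarith
    · exact not_mem_nb_of_b_pos (P.pt_mem (hr (-u) ⟨hupos.le, by linarith [hu.1]⟩).1)
        (by rw [P.b_pt (hr (-u) ⟨hupos.le, by linarith [hu.1]⟩).1]; exact hupos) h hz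
  · exfalso
    rw [himR ⟨hur.le, hu.2.le⟩, himL ⟨hu'.1.le, hul'⟩] at hι'
    have hz : P.pt (P.nb j h) (u, h) ∈ P.S (P.nb j h) := P.pt_mem (hr u ⟨hur.le, hu.2.le⟩).1
    rw [hι'] at hz
    rcases eq_or_lt_of_le (neg_nonneg.2 hul') with hu0 | hupos
    · have hb : P.b (P.nb j h) (P.pt (P.nb j h) (u, h)) = u := P.b_pt (hr u ⟨hur.le, hu.2.le⟩).1
      rw [hι', ← hu0] at hb
      have := (P.pt_axis_mem_nb (j := j) hh).2
      linarith
    · exact not_mem_nb_of_b_pos (P.pt_mem (hr (-u') ⟨hupos.le, by linarith [hu'.1]⟩).1)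
        (by rw [P.b_pt (hr (-u') ⟨hupos.le, by linarith [hu'.1]⟩).1]; exact hupos) h hz
  · rw [himR ⟨hur.le, hu.2.le⟩, himR ⟨hur'.le, hu'.2.le⟩] at hι'
    exact hinj _ ⟨hur.le, hu.2.le⟩ ⟨hur'.le, hu'.2.le⟩ hι'

/-! ## Adjacent prongs have opposite chart types -/

/-- **If the horizontals of `S j` have increasing leaf coordinate in `β` (read in a box `e` near a
parameter `b₀`), those of the neighbour `S (nb j h)` do not** (read in any box `e'` near any
parameter `b₀'`), at any height `h ≠ 0` in range. [folklore] -/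
theorem not_strictMonoOn_nb_of_strictMonoOn (hbi : IsBiOriented F) {j : ZMod n} {h : ℝ} (hh : h ∈ Icc (-P.ρ) P.ρ) (hh0 : h ≠ 0)
    {e : OpenPartialHomeomorph X (ℝ × ℝ)} (he : e ∈ F.atlas) {b₀ δ : ℝ} (hδ : 0 < δ) (hI : Icc (b₀ - δ) (b₀ + δ) ⊆ Ioo 0 P.ρ)
    (hsrc : P.horiz hι j h b₀ ∈ e.source) (hmono : StrictMonoOn (fun β ↦ (e (P.horiz hι j h β)).1) (Icc (b₀ - δ) (b₀ + δ)))
    {e' : OpenPartialHomeomorph X (ℝ × ℝ)} (he' : e' ∈ F.atlas) {b₀' δ' : ℝ} (hδ' : 0 < δ') (hI' : Icc (b₀' - δ') (b₀' + δ') ⊆ Ioo 0 P.ρ)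
    (hsrc' : P.horiz hι (P.nb j h) h b₀' ∈ e'.source) :
    ¬ StrictMonoOn (fun β ↦ (e' (P.horiz hι (P.nb j h) h β)).1) (Icc (b₀' - δ') (b₀' + δ')) := by
  intro hmono'
  set c := P.hypArc hι j h with hc
  have hcc := continuous_toLeafSpace_hypArc (P := P) (hι := hι) (j := j) hh hh0
  have hci := injOn_hypArc (P := P) (hι := hι) (j := j) hh hh0
  have hb₀ : b₀ ∈ Ioo 0 P.ρ := hI ⟨by linarith, by linarith⟩
  have hb₀' : b₀' ∈ Ioo 0 P.ρ := hI' ⟨by linarith, by linarith⟩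
  -- on the left half near `u₀ = -b₀` the arc is `β ↦ horiz j h β` with `β = -u`: decreasing coordinate in `u`
  have hleft : StrictAntiOn (fun u ↦ (e (c u)).1) (Icc (-b₀ - δ) (-b₀ + δ)) := by
    intro u hu u' hu' huu'
    have huI : -u ∈ Icc (b₀ - δ) (b₀ + δ) := ⟨by linarith [hu.2], by linarith [hu.1]⟩
    have hu'I : -u' ∈ Icc (b₀ - δ) (b₀ + δ) := ⟨by linarith [hu'.2], by linarith [hu'.1]⟩
    have hu0 : u ∈ Icc (-P.ρ) 0 := ⟨by linarith [(hI huI).2], by linarith [(hI huI).1]⟩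
    have hu'0 : u' ∈ Icc (-P.ρ) 0 := ⟨by linarith [(hI hu'I).2], by linarith [(hI hu'I).1]⟩
    show (e (c u')).1 < (e (c u)).1
    rw [hc, hypArc_of_nonpos hu0, hypArc_of_nonpos hu'0]
    exact hmono hu'I huI (by linarith)
  -- on the right half near `u₁ = b₀'` it is `β ↦ horiz (nb j h) h β` with `β = u`: increasing
  have hright : StrictMonoOn (fun u ↦ (e' (c u)).1) (Icc (b₀' - δ') (b₀' + δ')) := by
    intro u hu u' hu' huu'
    have hu0 : u ∈ Icc 0 P.ρ := ⟨(hI' hu).1.le, (hI' hu).2.le⟩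
    have hu'0 : u' ∈ Icc 0 P.ρ := ⟨(hI' hu').1.le, (hI' hu').2.le⟩
    show (e' (c u)).1 < (e' (c u')).1
    rw [hc, hypArc_of_nonneg hh hu0, hypArc_of_nonneg hh hu'0]
    exact hmono' hu hu' huu'
  -- but the chart sign of the arc is constant
  have hsrc₀ : c (-b₀) ∈ e.source := by
    rw [hc, hypArc_of_nonpos ⟨by linarith [hb₀.2], by linarith [hb₀.1]⟩, neg_neg]; exact hsrc
  have hsrc₁ : c b₀' ∈ e'.source := by rw [hc, hypArc_of_nonneg hh ⟨hb₀'.1.le, hb₀'.2.le⟩]; exact hsrc'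
  have hm₀ : (-b₀) ∈ Ioo (-P.ρ) P.ρ := ⟨by linarith [hb₀.2], by linarith [hb₀.1, P.ρ_pos]⟩
  have hm₁ : b₀' ∈ Ioo (-P.ρ) P.ρ := ⟨by linarith [hb₀'.1, P.ρ_pos], hb₀'.2⟩
  rcases forall_strictMonoOn_or_forall_strictAntiOn hbi hcc hci with hall | hall
  · obtain ⟨δ₀, hδ₀, hm⟩ := hall _ hm₀ e he hsrc₀
    exact not_strictMonoOn_and_strictAntiOn hδ₀ hδ hm hleft
  · obtain ⟨δ₁, hδ₁, ha⟩ := hall _ hm₁ e' he' hsrc₁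
    exact not_strictMonoOn_and_strictAntiOn hδ' hδ₁ hright ha

/-- **If the horizontals of `S j` have decreasing leaf coordinate in `β`, those of the neighbour do
not.** [folklore] -/
theorem not_strictAntiOn_nb_of_strictAntiOn (hbi : IsBiOriented F) {j : ZMod n} {h : ℝ} (hh : h ∈ Icc (-P.ρ) P.ρ) (hh0 : h ≠ 0)
    {e : OpenPartialHomeomorph X (ℝ × ℝ)} (he : e ∈ F.atlas) {b₀ δ : ℝ} (hδ : 0 < δ) (hI : Icc (b₀ - δ) (b₀ + δ) ⊆ Ioo 0 P.ρ)
    (hsrc : P.horiz hι j h b₀ ∈ e.source) (hanti : StrictAntiOn (fun β ↦ (e (P.horiz hι j h β)).1) (Icc (b₀ - δ) (b₀ + δ)))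
    {e' : OpenPartialHomeomorph X (ℝ × ℝ)} (he' : e' ∈ F.atlas) {b₀' δ' : ℝ} (hδ' : 0 < δ') (hI' : Icc (b₀' - δ') (b₀' + δ') ⊆ Ioo 0 P.ρ)
    (hsrc' : P.horiz hι (P.nb j h) h b₀' ∈ e'.source) :
    ¬ StrictAntiOn (fun β ↦ (e' (P.horiz hι (P.nb j h) h β)).1) (Icc (b₀' - δ') (b₀' + δ')) := by
  intro hanti'
  set c := P.hypArc hι j h with hc
  have hcc := continuous_toLeafSpace_hypArc (P := P) (hι := hι) (j := j) hh hh0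
  have hci := injOn_hypArc (P := P) (hι := hι) (j := j) hh hh0
  have hb₀ : b₀ ∈ Ioo 0 P.ρ := hI ⟨by linarith, by linarith⟩
  have hb₀' : b₀' ∈ Ioo 0 P.ρ := hI' ⟨by linarith, by linarith⟩
  have hleft : StrictMonoOn (fun u ↦ (e (c u)).1) (Icc (-b₀ - δ) (-b₀ + δ)) := by
    intro u hu u' hu' huu'
    have huI : -u ∈ Icc (b₀ - δ) (b₀ + δ) := ⟨by linarith [hu.2], by linarith [hu.1]⟩
    have hu'I : -u' ∈ Icc (b₀ - δ) (b₀ + δ) := ⟨by linarith [hu'.2], by linarith [hu'.1]⟩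
    have hu0 : u ∈ Icc (-P.ρ) 0 := ⟨by linarith [(hI huI).2], by linarith [(hI huI).1]⟩
    have hu'0 : u' ∈ Icc (-P.ρ) 0 := ⟨by linarith [(hI hu'I).2], by linarith [(hI hu'I).1]⟩
    show (e (c u)).1 < (e (c u')).1
    rw [hc, hypArc_of_nonpos hu0, hypArc_of_nonpos hu'0]
    exact hanti hu'I huI (by linarith)
  have hright : StrictAntiOn (fun u ↦ (e' (c u)).1) (Icc (b₀' - δ') (b₀' + δ')) := by
    intro u hu u' hu' huu'
    have hu0 : u ∈ Icc 0 P.ρ := ⟨(hI' hu).1.le, (hI' hu).2.le⟩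
    have hu'0 : u' ∈ Icc 0 P.ρ := ⟨(hI' hu').1.le, (hI' hu').2.le⟩
    show (e' (c u')).1 < (e' (c u)).1
    rw [hc, hypArc_of_nonneg hh hu0, hypArc_of_nonneg hh hu'0]
    exact hanti' hu hu' huu'
  have hsrc₀ : c (-b₀) ∈ e.source := by
    rw [hc, hypArc_of_nonpos ⟨by linarith [hb₀.2], by linarith [hb₀.1]⟩, neg_neg]; exact hsrc
  have hsrc₁ : c b₀' ∈ e'.source := by rw [hc, hypArc_of_nonneg hh ⟨hb₀'.1.le, hb₀'.2.le⟩]; exact hsrc'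
  have hm₀ : (-b₀) ∈ Ioo (-P.ρ) P.ρ := ⟨by linarith [hb₀.2], by linarith [hb₀.1, P.ρ_pos]⟩
  have hm₁ : b₀' ∈ Ioo (-P.ρ) P.ρ := ⟨by linarith [hb₀'.1, P.ρ_pos], hb₀'.2⟩
  rcases forall_strictMonoOn_or_forall_strictAntiOn hbi hcc hci with hall | hall
  · obtain ⟨δ₁, hδ₁, hm⟩ := hall _ hm₁ e' he' hsrc₁
    exact not_strictMonoOn_and_strictAntiOn hδ₁ hδ' hm hright
  · obtain ⟨δ₀, hδ₀, ha⟩ := hall _ hm₀ e he hsrc₀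
    exact not_strictMonoOn_and_strictAntiOn hδ hδ₀ hleft ha

end ProngStar

end Literature.Topology.PlanarFoliations
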